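import Literature.NumberTheory.Weil1964.ArchMetaplecticSubgroup
import HarnessLib

/-!
# Unit scalars, Schur's lemma in group form, and the normality of Folland's `Mp₂(W)` in `Mp^𝓢(W)` (given R1, R2)

Topic `NumberTheory/Weil1964`; namespace `Literature.NumberTheory.Weil1964.MpS`.  Continuation of
`Literature.NumberTheory.Weil1964.ArchMetaplecticDoubleCover` / `ArchMetaplecticSubgroup` (`Mp^𝓢(W)` = `MpS σ`; Folland's block `Sp.follandP`;
the vacuum coefficient `MpS.vac`; Folland's normalisation `MpS.IsMetaplectic x : C(x)² · det P(proj x) = 1`, whose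
locus is the metaplectic double cover `Mp₂(W)`; the two cited records R1 `Folland1989_Thm_4_37_ab` (existence of a
normalised implementer over every `g`) and R2 `Folland1989_Thm_4_37_c` (closure under composition)).

This small file (pub-hodgecm2 literature fan-out, row B08-2 (b) [Paul1998, (1.2.1)], reduction layer; the input of
`ArchMetaplecticLeviCover` and `ArchMetaplecticDoublingSection`) proves, with no Gaussian integral evaluated:

* §0 unit scalars `c · 1` are CENTRAL in `Mp^𝓢(W)` (`unitScalar_mul_comm`), multiply (`unitScalar_mul_unitScalar`),
  `C(c · x) = c C(x)`, and Schur's lemma in GROUP form: two elements over the same `g` satisfy `y = (c · 1) x`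
  (`exists_eq_unitScalar_mul_of_proj_eq`);
* §1 two consequences of R1: EVERY implementer `y ∈ Mp^𝓢(W)` has `‖C(y)‖² · ‖det P(proj y)‖ = 1`
  (`norm_vac_sq_mul_norm_det`) — Folland's `|⟨ν(𝒜)E₀, E₀⟩| = |det P|^{-1/2}` [Folland1989, (4.36)] for every choice of
  the phase — in particular `C(y) ≠ 0`; and, with R2 (and the inverse-closure `IsMetaplectic.inv` of
  `ArchMetaplecticSubgroup`), Folland's normalisation is stable under CONJUGATION BY ALL OF `Mp^𝓢(W)`
  (`IsMetaplectic.conj_of`): `Mp₂(W)` is a normal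
  subgroup of `Mp^𝓢(W)`, so a metaplectic section over a subgroup `H ≤ Sp(W)` may be conjugated by ANY implementer of
  a fixed `h ∈ Sp(W)` to a metaplectic section over `h H h⁻¹` (used for the Siegel Levi and the doubling diagonal in the
  sequels).

The maximal compact `U(σ)` (the `det^{-1/2}`-cover `K̃`) is NOT treated here: its names of record are those of
`Literature.NumberTheory.Weil1964.ArchMetaplecticSubgroup` (row B08-2 (a)).  Everything here is PROVED (kernel); R1/R2
enter only as explicit hypotheses of the §1 theorems that use them; citations record provenance only.

## References

* [Folland1989] G. B. Folland, *Harmonic Analysis in Phase Space*, Princeton UP 1989: §4.2 (4.23), (4.36), Thm. (4.37).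
* [Paul1998] A. Paul, *Howe correspondence for real unitary groups*, J. Funct. Anal. 159 (1998) 384–431, §1.2 (1.2.1).
-/

set_option autoImplicit false

noncomputable section

open MeasureTheory Complex SchwartzMap Matrix
open scoped InnerProductSpace ComplexConjugate Real

namespace Literature.NumberTheory.Weil1964

open Literature.Analysis.SegalBargmann Literature.RepresentationTheory.HeisenbergGroup

variable {σ : Type*} [Fintype σ] [DecidableEq σ]


namespace MpS

/-! ## 0. Unit scalars commute with everything; Schur in group form -/

omit [DecidableEq σ] in
/-- A unit scalar `c · 1 ∈ Mp^𝓢(W)` is central. [cite: Folland1989, §4.2 (4.23)] -/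
theorem unitScalar_mul_comm (c : ℂ) (hc : ‖c‖ = 1) (x : MpS σ) : unitScalar c hc * x = x * unitScalar c hc :=
  ext' (by rw [map_mul, map_mul, proj_unitScalar, one_mul, mul_one]) fun f => by
    rw [mul_apply, mul_apply, unitScalar_apply, unitScalar_apply, map_smul]

omit [DecidableEq σ] in
/-- `(c · 1)(c' · 1) = (c c') · 1`. [cite: Folland1989, §4.2 (4.23)] -/
theorem unitScalar_mul_unitScalar (c c' : ℂ) (hc : ‖c‖ = 1) (hc' : ‖c'‖ = 1) :
    unitScalar c hc * unitScalar c' hc' = unitScalar (σ := σ) (c * c') (by rw [norm_mul, hc, hc', mul_one]) :=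
  ext' (by rw [map_mul, proj_unitScalar, proj_unitScalar, proj_unitScalar, mul_one]) fun f => by
    rw [mul_apply, unitScalar_apply, unitScalar_apply, unitScalar_apply, smul_smul]

omit [DecidableEq σ] in
/-- `1 · 1 = 1`. [cite: Folland1989, §4.2 (4.23)] -/
@[simp] theorem unitScalar_one : unitScalar (σ := σ) 1 norm_one = 1 :=
  ext' rfl fun f => by rw [unitScalar_apply, one_smul]; rfl

omit [DecidableEq σ] in
/-- `(−1) · 1 = −1`. [cite: Folland1989, §4.2 p. 156] -/
theorem unitScalar_neg_one (h : ‖(-1 : ℂ)‖ = 1) : unitScalar (σ := σ) (-1) h = negOne := rfl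

/-- `C(c · x) = c C(x)`. [cite: Folland1989, §4.2 (4.36)] -/
theorem vac_unitScalar_mul (c : ℂ) (hc : ‖c‖ = 1) (x : MpS σ) : vac (unitScalar c hc * x) = c * vac x :=
  vac_eq_mul_of_smul fun f => by rw [mul_apply, unitScalar_apply]

/-- **Schur, group form**: two elements of `Mp^𝓢(W)` over the same `g` differ by a unit scalar IN THE GROUP:
`y = (c · 1) x`. [cite: Folland1989, §4.2 (4.23)] -/
theorem exists_eq_unitScalar_mul_of_proj_eq {x y : MpS σ} (h : proj x = proj y) :
    ∃ (c : ℂ) (hc : ‖c‖ = 1), y = unitScalar c hc * x := by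
  obtain ⟨c, hc, hcf⟩ := exists_unitSmul_of_proj_eq h
  exact ⟨c, hc, ext' (by rw [map_mul, proj_unitScalar, one_mul, h]) fun f => by rw [hcf, mul_apply, unitScalar_apply]⟩

/-! ## 1. Consequences of R1: `|C|² |det P| = 1` for every implementer; normality of `Mp₂(W)` -/

/-- **`‖C(y)‖² · ‖det P(proj y)‖ = 1` for EVERY `y ∈ Mp^𝓢(W)`** (given R1): `y = c · x` with `x` normalised and
`|c| = 1` — Folland's `|⟨ν(𝒜)E₀, E₀⟩| = |det^{-1/2} P|`, valid for every choice of the phase. [cite: Folland1989, §4.2 (4.36), Thm. (4.37)] -/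
theorem norm_vac_sq_mul_norm_det (h1 : Folland1989_Thm_4_37_ab σ) (y : MpS σ) :
    ‖vac y‖ ^ 2 * ‖(Sp.follandP (proj y)).det‖ = 1 := by
  obtain ⟨x, hx, hxm⟩ := h1 (proj y)
  obtain ⟨c, hc, rfl⟩ := exists_eq_unitScalar_mul_of_proj_eq (x := x) (y := y) hx
  have key : vac x ^ 2 * (Sp.follandP (proj x)).det = 1 := hxm
  rw [vac_unitScalar_mul, map_mul, proj_unitScalar, one_mul, norm_mul, mul_pow, hc, one_pow, one_mul, ← norm_pow,
    ← norm_mul, key, norm_one]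

/-- Hence EVERY implementer has a non-zero vacuum coefficient (given R1). [cite: Folland1989, §4.2 (4.36)] -/
theorem vac_ne_zero_of_thm_4_37_ab (h1 : Folland1989_Thm_4_37_ab σ) (y : MpS σ) : vac y ≠ 0 := by
  intro h
  have := norm_vac_sq_mul_norm_det h1 y
  rw [h, norm_zero, zero_pow two_ne_zero, zero_mul] at this
  exact zero_ne_one this

/-- **`Mp₂(W)` is normal in `Mp^𝓢(W)`** (given R1, R2): `y x y⁻¹` is normalised whenever `x` is, for EVERY implementer
`y` — `y = c · z` with `z` normalised (R1 + Schur), and `c` cancels. [cite: Folland1989, §4.2 Thm. (4.37)] -/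
theorem IsMetaplectic.conj_of (h1 : Folland1989_Thm_4_37_ab σ) (h2 : Folland1989_Thm_4_37_c σ) {x : MpS σ}
    (hx : IsMetaplectic x) (y : MpS σ) : IsMetaplectic (y * x * y⁻¹) := by
  obtain ⟨z, hz, hzm⟩ := h1 (proj y)
  obtain ⟨c, hc, rfl⟩ := exists_eq_unitScalar_mul_of_proj_eq (x := z) (y := y) hz
  have e : unitScalar c hc * z * x * (unitScalar c hc * z)⁻¹ = z * x * z⁻¹ := by
    rw [_root_.mul_inv_rev, show unitScalar c hc * z * x * (z⁻¹ * (unitScalar c hc)⁻¹) =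
        (unitScalar c hc * (z * x * z⁻¹)) * (unitScalar c hc)⁻¹ by simp only [mul_assoc],
      unitScalar_mul_comm, mul_inv_cancel_right]
  rw [e]
  exact h2 _ _ (h2 _ _ hzm hx) (hzm.inv h1 h2)


end MpS

end Literature.NumberTheory.Weil1964

end
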